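import Summits.CriticalPhenomena.PercolationContinuityZ3.Theorems.SahiAEPlanePrelim

/-!
# Sharpness: an unbounded supermodular function on the open square with NO real-valued supermodular extension / version

Support file of the Sahi cell (`prim-sahi`, typer seat, generation 22; `--supports stmt-CriticalPhenomena-4575`).
Theorems only (no definitions, no named facts, no sorries).

Two hypotheses of this generation's theorems are shown to be necessary:

* the BOUNDEDNESS in the box extension theorem (`exists_supermodular_extension_of_box`): the function
  `φ(s, t) = −t/s` is supermodular at every pair of the open unit square, yet NO real-valued function on `ℝ²` which
  agrees with it almost everywhere on the square is supermodular at every pair of `ℝ²`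
  (`Plane.no_real_supermodular_version_neg_div`): increasing differences across the face `s = 0` would force
  `ψ(0, t) − ψ(0, t') ≤ −(t − t')/sₙ → −∞`;
* the ZEROS of the transported versions (`Plane.exists_measurable_mtp2_version_of_ae_pi_plane`: under a product
  reference measure the finite version may vanish off the essential rectangle): for the reference measure
  `λ|_{(0,1)²}` (a product of two σ-finite measures on `ℝ`) the additive form of the planar structure theorem FAILS —
  `Plane.exists_ae_supermodular_restrict_without_real_version` — so `e^{ψ}` must be allowed to vanish somewhere.

No sorries, no new axioms.
-/

noncomputable section

namespace Summit.CriticalPhenomena.PercolationContinuityZ3.Theorems.SahiAEFourFunctions.Plane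

open MeasureTheory Set Filter Topology Function
open scoped ENNReal NNReal

/-- First coordinate of an explicit point. [folklore] -/
@[simp] private theorem vz' (s t : ℝ) : (![s, t] : Fin 2 → ℝ) 0 = s := rfl

/-- Second coordinate of an explicit point. [folklore] -/
@[simp] private theorem vo' (s t : ℝ) : (![s, t] : Fin 2 → ℝ) 1 = t := rfl

/-- A point of the plane is the vector of its two coordinates. [folklore] -/
private theorem eta'' (x : Fin 2 → ℝ) : x = ![x 0, x 1] := by
  ext i; fin_cases i <;> rfl

/-- `φ(s,t) = −t/s` is supermodular at every pair of the open unit square (indeed of the open right half-plane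
`{s > 0}`): for `s < s'`, `t' < t` the rectangle increment is `(t − t')(1/s − 1/s') ≥ 0`. [folklore] -/
theorem supermodular_neg_div {x y : Fin 2 → ℝ} (hx : 0 < x 0) (hy : 0 < y 0) :
    (fun z : Fin 2 → ℝ => -(z 1 / z 0)) x + (fun z : Fin 2 → ℝ => -(z 1 / z 0)) y ≤
      (fun z : Fin 2 → ℝ => -(z 1 / z 0)) (x ⊓ y) + (fun z : Fin 2 → ℝ => -(z 1 / z 0)) (x ⊔ y) := by
  obtain ⟨a, c, rfl⟩ : ∃ a c : ℝ, x = ![a, c] := ⟨x 0, x 1, eta'' x⟩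
  obtain ⟨a', c', rfl⟩ : ∃ a' c' : ℝ, y = ![a', c'] := ⟨y 0, y 1, eta'' y⟩
  simp only [vz', vo', vec_inf_vec, vec_sup_vec] at hx hy ⊢
  rcases le_total a a' with h0 | h0 <;> rcases le_total c c' with h1 | h1
  · rw [min_eq_left h0, min_eq_left h1, max_eq_right h0, max_eq_right h1]
  · rw [min_eq_left h0, min_eq_right h1, max_eq_right h0, max_eq_left h1]
    rw [show -(c / a) + -(c' / a') = -(c' / a) + -(c / a') - (c - c') * (a' - a) / (a * a') by
      field_simp; ring]
    have : 0 ≤ (c - c') * (a' - a) / (a * a') := div_nonneg (mul_nonneg (by linarith) (by linarith)) (by positivity)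
    linarith
  · rw [min_eq_right h0, min_eq_left h1, max_eq_left h0, max_eq_right h1]
    rw [show -(c / a) + -(c' / a') = -(c / a') + -(c' / a) - (c' - c) * (a - a') / (a * a') by
      field_simp; ring]
    have : 0 ≤ (c' - c) * (a - a') / (a * a') := div_nonneg (mul_nonneg (by linarith) (by linarith)) (by positivity)
    linarith
  · rw [min_eq_right h0, min_eq_right h1, max_eq_left h0, max_eq_left h1]
    linarith

/-- **No real-valued everywhere-supermodular function agrees with `−t/s` almost everywhere on the open unit square.**
[this work] -/
theorem no_real_supermodular_version_neg_div (ψ : (Fin 2 → ℝ) → ℝ)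
    (hψ : ∀ᵐ x ∂(volume : Measure (Fin 2 → ℝ)).restrict (Set.pi univ fun _ => Ioo (0 : ℝ) 1), ψ x = -(x 1 / x 0))
    (hsm : ∀ x y, ψ x + ψ y ≤ ψ (x ⊓ y) + ψ (x ⊔ y)) : False := by
  set U : Set (Fin 2 → ℝ) := Set.pi univ fun _ => Ioo (0 : ℝ) 1 with hU
  set μ : Measure (Fin 2 → ℝ) := (volume : Measure (Fin 2 → ℝ)).restrict U with hμ
  set ν : Measure ℝ := (volume : Measure ℝ).restrict (Ioo (0 : ℝ) 1) with hν
  have hμpi : μ = Measure.pi fun _ : Fin 2 => ν := by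
    rw [hμ, hU, volume_pi, Measure.restrict_pi_pi]
  -- Fubini: for a.e. `s`, `ψ(s, t) = −t/s` for a.e. `t`
  have he : MeasurePreserving (MeasurableEquiv.finTwoArrow (α := ℝ)) μ (ν.prod ν) := by
    rw [hμpi]; exact measurePreserving_finTwoArrow ν
  have h1 : ∀ᵐ q ∂ν.prod ν, ψ ![q.1, q.2] = -(q.2 / q.1) := by
    have := he.symm.quasiMeasurePreserving.ae hψ
    filter_upwards [this] with q hq
    have e : (MeasurableEquiv.finTwoArrow (α := ℝ)).symm q = ![q.1, q.2] := by
      ext i; fin_cases i <;> simp [MeasurableEquiv.finTwoArrow]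
    simpa [e] using hq
  have h2 : ∀ᵐ s ∂ν, ∀ᵐ t ∂ν, ψ ![s, t] = -(t / s) :=
    Measure.ae_ae_of_ae_prod (p := fun q : ℝ × ℝ => ψ ![q.1, q.2] = -(q.2 / q.1)) h1
  -- positive measure of small intervals under `ν`
  have hνpos : ∀ a b : ℝ, 0 ≤ a → a < b → b ≤ 1 → ν (Ioo a b) ≠ 0 := by
    intro a b ha hab hb1
    rw [hν, Measure.restrict_apply measurableSet_Ioo,
      Set.inter_eq_self_of_subset_left (Set.Ioo_subset_Ioo ha hb1), Real.volume_Ioo]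
    exact (ENNReal.ofReal_pos.2 (by linarith)).ne'
  -- a sequence of good `s_n < 1/(n+1)`
  have hsn : ∀ n : ℕ, ∃ s : ℝ, 0 < s ∧ s < ((n : ℝ) + 1)⁻¹ ∧ ∀ᵐ t ∂ν, ψ ![s, t] = -(t / s) := by
    intro n
    by_contra hne
    have hpos : (0 : ℝ) < ((n : ℝ) + 1)⁻¹ := by positivity
    have hle1 : ((n : ℝ) + 1)⁻¹ ≤ 1 := inv_le_one_of_one_le₀ (by have := Nat.cast_nonneg (α := ℝ) n; linarith)
    apply hνpos 0 _ le_rfl hpos hle1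
    refine measure_mono_null (fun s hs => ?_) (ae_iff.1 h2)
    intro hgood
    exact hne ⟨s, hs.1, hs.2, hgood⟩
  choose sq hsq0 hsq1 hsq using hsn
  -- generic `t' < t`
  have hall : ∀ᵐ t ∂ν, ∀ n, ψ ![sq n, t] = -(t / sq n) := ae_all_iff.2 hsq
  obtain ⟨t, ⟨ht1, ht2⟩, ht⟩ : ∃ t ∈ Ioo (2⁻¹ : ℝ) 1, ∀ n, ψ ![sq n, t] = -(t / sq n) := by
    by_contra hne
    apply hνpos 2⁻¹ 1 (by norm_num) (by norm_num) le_rfl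
    refine measure_mono_null (fun t ht => ?_) (ae_iff.1 hall)
    intro h
    exact hne ⟨t, ht, h⟩
  obtain ⟨t', ⟨ht1', ht2'⟩, ht'⟩ : ∃ t' ∈ Ioo (0 : ℝ) 2⁻¹, ∀ n, ψ ![sq n, t'] = -(t' / sq n) := by
    by_contra hne
    apply hνpos 0 2⁻¹ le_rfl (by norm_num) (by norm_num)
    refine measure_mono_null (fun t ht => ?_) (ae_iff.1 hall)
    intro h
    exact hne ⟨t, ht, h⟩
  have htt' : t' < t := ht2'.trans ht1
  -- increasing differences across the face `s = 0`
  have hineq : ∀ n, ψ ![0, t] - ψ ![0, t'] ≤ -((t - t') / sq n) := by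
    intro n
    have h := rect_of_supermodular hsm (s := 0) (s' := sq n) (t := t') (t' := t) (hsq0 n).le htt'.le
    rw [ht n, ht' n] at h
    have : -(t / sq n) - -(t' / sq n) = -((t - t') / sq n) := by ring
    linarith
  -- but `(t − t')/sₙ → ∞`
  set C := ψ ![0, t] - ψ ![0, t'] with hC
  obtain ⟨n, hn⟩ := exists_nat_gt (|C| / (t - t'))
  have hpos : 0 < t - t' := sub_pos.2 htt'
  have h3 : (t - t') * ((n : ℝ) + 1) < (t - t') / sq n := by
    rw [lt_div_iff₀ (hsq0 n)]
    have := hsq1 n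
    have h4 : sq n * ((n : ℝ) + 1) < 1 := by
      have := mul_lt_mul_of_pos_right this (show (0 : ℝ) < (n : ℝ) + 1 by positivity)
      rwa [inv_mul_cancel₀ (by positivity : ((n : ℝ) + 1) ≠ 0)] at this
    nlinarith
  have h5 : |C| < (t - t') * ((n : ℝ) + 1) := by
    rw [div_lt_iff₀ hpos] at hn; nlinarith
  have h6 := hineq n
  have h7 : -|C| ≤ C := neg_abs_le C
  linarith

/-- **The additive planar structure theorem fails for the reference measure `λ|_{(0,1)²}`** (a product of two σ-finite
measures on `ℝ`): there is a measurable `φ`, supermodular on `(λ|_U) ⊗ (λ|_U)`-almost every pair (indeed at every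
pair of `U`), with no real-valued everywhere-supermodular function equal to it `λ|_U`-a.e. — so in
`Plane.exists_measurable_mtp2_version_of_ae_pi_plane` the version must be allowed to vanish somewhere, and in
`exists_supermodular_extension_of_box` boundedness cannot be dropped. [this work] -/
theorem exists_ae_supermodular_restrict_without_real_version :
    ∃ φ : (Fin 2 → ℝ) → ℝ, Measurable φ ∧
      (∀ x ∈ Set.pi univ (fun _ : Fin 2 => Ioo (0 : ℝ) 1), ∀ y ∈ Set.pi univ (fun _ : Fin 2 => Ioo (0 : ℝ) 1),
        φ x + φ y ≤ φ (x ⊓ y) + φ (x ⊔ y)) ∧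
      (∀ᵐ p ∂((volume : Measure (Fin 2 → ℝ)).restrict (Set.pi univ fun _ => Ioo (0 : ℝ) 1)).prod
          ((volume : Measure (Fin 2 → ℝ)).restrict (Set.pi univ fun _ => Ioo (0 : ℝ) 1)),
        φ p.1 + φ p.2 ≤ φ (p.1 ⊓ p.2) + φ (p.1 ⊔ p.2)) ∧
      ¬ ∃ ψ : (Fin 2 → ℝ) → ℝ,
        (ψ =ᵐ[(volume : Measure (Fin 2 → ℝ)).restrict (Set.pi univ fun _ => Ioo (0 : ℝ) 1)] φ) ∧
          ∀ x y, ψ x + ψ y ≤ ψ (x ⊓ y) + ψ (x ⊔ y) := by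
  set U : Set (Fin 2 → ℝ) := Set.pi univ fun _ => Ioo (0 : ℝ) 1 with hU
  have mU : MeasurableSet U := MeasurableSet.univ_pi fun _ => measurableSet_Ioo
  have hpt : ∀ x ∈ U, ∀ y ∈ U, (fun z : Fin 2 → ℝ => -(z 1 / z 0)) x + (fun z : Fin 2 → ℝ => -(z 1 / z 0)) y ≤
      (fun z : Fin 2 → ℝ => -(z 1 / z 0)) (x ⊓ y) + (fun z : Fin 2 → ℝ => -(z 1 / z 0)) (x ⊔ y) :=
    fun x hx y hy => supermodular_neg_div (Set.mem_univ_pi.1 hx 0).1 (Set.mem_univ_pi.1 hy 0).1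
  refine ⟨fun z => -(z 1 / z 0), ((measurable_pi_apply 1).div (measurable_pi_apply 0)).neg, hpt, ?_, ?_⟩
  · have h1 : ∀ᵐ p ∂((volume : Measure (Fin 2 → ℝ)).restrict U).prod ((volume : Measure (Fin 2 → ℝ)).restrict U),
        p.1 ∈ U ∧ p.2 ∈ U := by
      rw [Measure.prod_restrict]
      filter_upwards [ae_restrict_mem (mU.prod mU)] with p hp using hp
    filter_upwards [h1] with p hp using hpt p.1 hp.1 p.2 hp.2
  · rintro ⟨ψ, hψ, hsm⟩
    exact no_real_supermodular_version_neg_div ψ (by filter_upwards [hψ] with x hx using hx) hsm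

end Summit.CriticalPhenomena.PercolationContinuityZ3.Theorems.SahiAEFourFunctions.Plane
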